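import Literature.NumberTheory.Automorphic.UnitaryGroupBorelHeightBigCellTwo
import Literature.NumberTheory.Automorphic.AdelicHeightZetaUniform
import HarnessLib

/-!
# High in the cusp the non-Borel terms of the kernel vanish on `U(J₂)`: `K(g, g) = Σ_{β ∈ B(F)} f(g⁻¹ β g)` for `H(g) > c₀(f)`
# (the `N = 2` twin of ★ `UnitaryGroupKernelOffBorelVanishing`)
(Rogawski, *Automorphic Representations of Unitary Groups in Three Variables* (1990), §2.2 p. 13: on the Siegel set and for `T` large the
truncated kernel is `K(x,x) − K_B(x,x)` — «Let `G = U(3)`, `U(2)`, or `U(2) × U(1)`», p. 98; Arthur, Duke Math. J. 45 (1978), §§6–7; Garrett,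
*Modern Analysis of Automorphic Forms by Example* (2018), §1.5, §2.3 and Thm. 2.2.2)

Topic `NumberTheory/Automorphic`; namespace `Literature.NumberTheory.Automorphic.UnitaryGroup`. THEOREMS ONLY over accepted tree modules
(no definition, no named fact, no instance, no `sorry`). H-side copy of LAWS 1–5 for `H = U(Φ₂) × U(Φ₁)` (hodgecm-mathlib, F0P3a LEAD
WORD #123; census `CENSUS-LAWS-Hside` §3 LAW 1, sibling #1): the accepted ★ `UnitaryGroupKernelOffBorelVanishing` is typed for `U(J₃)`;
this file re-types it for `U(J₂)` (★ `quasiSplit F E c 2`) over the `U(J₂)` Siegel property ★ `UnitaryGroupBorelHeightBigCellTwo`, with the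
proofs of the `N = 3` file verbatim (they are rank-one generic); names suffixed `_two`.

THE STATEMENT. `G = U(J₂)` (★ `quasiSplit F E c 2`), `H = borelHeight`, `B(F) =` ★ `arithmeticBorel F E c 2 ≤ G(F) =` ★ `arithmeticSubgroup`.
For a compact `Ω ⊆ G(𝔸_F)` there is `c₀` such that **`g⁻¹ γ g ∈ Ω` with `γ ∈ G(F) ∖ B(F)` forces `H(g) ≤ c₀`**
(`exists_borelHeight_le_of_conj_mem_of_not_mem_arithmeticBorel_two`); hence for `f` of compact support, **`H(g) > c₀ ⇒ f(g⁻¹ γ g) = 0` for every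
`γ ∈ G(F) ∖ B(F)`** (`exists_forall_apply_conj_eq_zero_of_not_mem_arithmeticBorel_two`) and **`K(g, g) = Σ_{β ∈ B(F)} f(g⁻¹ β g)`**, i.e. ★ `kernel f g g`
`=` ★ `borelSum f g g` (`exists_kernel_eq_borelSum_of_lt_borelHeight_two`) — the kernel of `ρ(f)` on the diagonal reduces to its Borel part high in
the cusp, the first step of «`k^T(x) = K(x,x) − K_B(x,x)` for `x` in the Siegel set, `T` large» towards the integrability of `k^T` on `U(J₂)`.

PROOF. `γ g = g ω` with `ω = g⁻¹ γ g ∈ Ω`, so `e₂ (γ g) = e₂ g · ω` and `h(e₂ γ g) ≤ H_mat(ω) · h(e₂ g) ≤ B_Ω · h(e₂ g)` (★ `vecHeight_vecMul_le`,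
★ `exists_matHeightBound_le_of_isCompact` — Godement's «compact parts of `GL(V_A)` distort heights boundedly»); with ★ `one_le_vecHeight_lastRow_mul`
(`1 ≤ h(e₂ γ g) · h(e₂ g)` in the big cell `γ₁₀ ≠ 0`, which for `U(J₂)` is exactly `γ ∉ B`, ★ `apply_top_zero_ne_zero_of_not_mem_borelAdelic_two`)
this gives `1 ≤ B_Ω · h(e₂ g)²`, i.e. `H(g)² ≤ B_Ω`, so `H(g) ≤ max(1, B_Ω)`.

## References

* J. D. Rogawski, *Automorphic Representations of Unitary Groups in Three Variables*, Ann. of Math. Stud. 123 (1990), §2.2 p. 13, §7.3 p. 98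
  [Rogawski1990].
* P. Garrett, *Modern Analysis of Automorphic Forms by Example* (2018), §1.5, Thm. 2.2.2, §2.3 [Garrett2018].
* R. Godement, *Domaines fondamentaux des groupes arithmétiques*, Sém. Bourbaki 257 (1962/63), §1.1 (vi) [Godement1964].
-/

set_option autoImplicit false

noncomputable section

open NumberField IsDedekindDomain Matrix
open scoped NNReal MatrixGroups

namespace Literature.NumberTheory.Automorphic

namespace UnitaryGroup

variable {F E : Type} [Field F] [NumberField F] [Field E] [NumberField E] [Algebra F E] {c : E ≃ₐ[F] E}

/-- **Conjugating `γ ∈ G(F) ∖ B(F)` into a compact set bounds the height**: for compact `Ω ⊆ U(J₂)(𝔸_F)` there is `c₀` with `H(g) ≤ c₀`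
whenever `g⁻¹ γ g ∈ Ω` for some `γ ∈ G(F) ∖ B(F)` (`H(γg) H(g) ≤ 1` from ★ `UnitaryGroupBorelHeightBigCell`, and `H(γ g) = H(g ω) ≥ H(g) ∕ B_Ω` from
Godement's bounded distortion ★ `exists_matHeightBound_le_of_isCompact`, ★ `vecHeight_vecMul_le`). [cite: Garrett2018, §2.3 and Thm. 2.2.2]
[cite: Rogawski1990, §2.2 p. 13] -/
theorem exists_borelHeight_le_of_conj_mem_of_not_mem_arithmeticBorel_two {Ω : Set (quasiSplit F E c 2).Adelic} (hΩ : IsCompact Ω) :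
    ∃ c₀ : ℝ≥0, ∀ (g : (quasiSplit F E c 2).Adelic) (γ : (quasiSplit F E c 2).arithmeticSubgroup), γ ∉ arithmeticBorel F E c 2 →
      g⁻¹ * (γ : (quasiSplit F E c 2).Adelic) * g ∈ Ω → borelHeight g ≤ c₀ := by
  -- Godement's bound on the compact set of matrices of `Ω`
  have hC : IsCompact ((fun ω : (quasiSplit F E c 2).Adelic =>
      ((adelicVal F E c 2 _ ω : GL (Fin 2) (AdeleRing (𝓞 E) E)) : Matrix (Fin 2) (Fin 2) (AdeleRing (𝓞 E) E))) '' Ω) :=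
    hΩ.image (Units.continuous_val.comp continuous_subtype_val)
  obtain ⟨B, hB⟩ := exists_matHeightBound_le_of_isCompact E hC
  refine ⟨max 1 B, fun g γ hγ hω => ?_⟩
  obtain ⟨γ₀, hγ₀⟩ := MonoidHom.mem_range.mp γ.2
  set ω : (quasiSplit F E c 2).Adelic := g⁻¹ * (γ : (quasiSplit F E c 2).Adelic) * g with hω_def
  -- `γ g = g ω`, so `e₂ (γ g) = e₂ g · ω`
  have hγg : (γ : (quasiSplit F E c 2).Adelic) * g = g * ω := by rw [hω_def]; group
  have hrow : lastRow ((quasiSplit F E c 2).toAdelic γ₀ * g) =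
      lastRow g ᵥ* ((adelicVal F E c 2 _ ω : GL (Fin 2) (AdeleRing (𝓞 E) E)) : Matrix (Fin 2) (Fin 2) (AdeleRing (𝓞 E) E)) := by
    rw [hγ₀, hγg, lastRow_mul]
  -- `1 ≤ h(e₂ γ g) h(e₂ g) ≤ B h(e₂ g)²`
  have h1 := one_le_vecHeight_lastRow_mul γ₀ (apply_top_zero_ne_zero_of_not_mem_borelAdelic_two (c := c) fun h => hγ (by
    rw [mem_arithmeticBorel_iff, ← hγ₀]; exact h)) g
  have h2 : vecHeight E (lastRow ((quasiSplit F E c 2).toAdelic γ₀ * g)) ≤ B * vecHeight E (lastRow g) := by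
    rw [hrow]
    refine (vecHeight_vecMul_le (isHeightFinite_lastRow g) ?_).trans (mul_le_mul' (hB _ ⟨ω, hω, rfl⟩) le_rfl)
    rw [← hrow]; exact isHeightFinite_lastRow _
  have h3 : 1 ≤ B * (vecHeight E (lastRow g) * vecHeight E (lastRow g)) := by
    calc (1 : ℝ≥0) ≤ vecHeight E (lastRow ((quasiSplit F E c 2).toAdelic γ₀ * g)) * vecHeight E (lastRow g) := h1
      _ ≤ B * vecHeight E (lastRow g) * vecHeight E (lastRow g) := mul_le_mul' h2 le_rfl
      _ = B * (vecHeight E (lastRow g) * vecHeight E (lastRow g)) := mul_assoc _ _ _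
  -- hence `H(g)² ≤ B` and `H(g) ≤ max 1 B`
  set h : ℝ≥0 := vecHeight E (lastRow g) with hh
  have hh0 : h ≠ 0 := by
    intro h0; rw [h0, mul_zero, mul_zero] at h3; exact absurd h3 (not_le.mpr zero_lt_one)
  have hsq : borelHeight g * borelHeight g ≤ B := by
    rw [borelHeight_def, ← hh, ← mul_inv]
    have hpos : 0 < h * h := pos_iff_ne_zero.mpr (mul_ne_zero hh0 hh0)
    rw [inv_le_iff_one_le_mul₀ hpos]
    exact h3
  by_contra hlt
  rw [not_le, max_lt_iff] at hlt
  have hH : borelHeight g ≤ borelHeight g * borelHeight g := by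
    simpa using mul_le_mul' hlt.1.le (le_refl (borelHeight g))
  exact absurd (hH.trans hsq) (not_le.mpr hlt.2)

/-- **High in the cusp the non-Borel terms vanish**: for `f` of compact support on `U(J₂)(𝔸_F)` there is `c₀` such that `H(g) > c₀` implies
`f(g⁻¹ γ g) = 0` for every `γ ∈ G(F) ∖ B(F)`. [cite: Rogawski1990, §2.2 p. 13] [cite: Garrett2018, §2.3] -/
theorem exists_forall_apply_conj_eq_zero_of_not_mem_arithmeticBorel_two {M : Type*} [Zero M] [TopologicalSpace M]
    {f : (quasiSplit F E c 2).Adelic → M} (hf : HasCompactSupport f) :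
    ∃ c₀ : ℝ≥0, ∀ g : (quasiSplit F E c 2).Adelic, c₀ < borelHeight g →
      ∀ γ : (quasiSplit F E c 2).arithmeticSubgroup, γ ∉ arithmeticBorel F E c 2 →
        f (g⁻¹ * (γ : (quasiSplit F E c 2).Adelic) * g) = 0 := by
  obtain ⟨c₀, hc₀⟩ := exists_borelHeight_le_of_conj_mem_of_not_mem_arithmeticBorel_two (c := c) hf.isCompact
  refine ⟨c₀, fun g hg γ hγ => ?_⟩
  by_contra hne
  exact absurd (hc₀ g γ hγ (subset_tsupport f (Function.mem_support.mpr hne))) (not_le.mpr hg)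

/-- **`K(g, g) = Σ_{β ∈ B(F)} f(g⁻¹ β g)` high in the cusp**: for `f` of compact support there is `c₀` such that for `H(g) > c₀` the kernel of
`ρ(f)` on the diagonal (★ `kernel`) equals its Borel part (★ `borelSum`) — only `γ ∈ B(F)` contribute. [cite: Rogawski1990, §2.2 p. 13]
[cite: Garrett2018, §2.3] -/
theorem exists_kernel_eq_borelSum_of_lt_borelHeight_two {f : (quasiSplit F E c 2).Adelic → ℂ} (hf : HasCompactSupport f) :
    ∃ c₀ : ℝ≥0, ∀ g : (quasiSplit F E c 2).Adelic, c₀ < borelHeight g → kernel f g g = borelSum f g g := by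
  obtain ⟨c₀, hc₀⟩ := exists_forall_apply_conj_eq_zero_of_not_mem_arithmeticBorel_two (c := c) hf
  refine ⟨c₀, fun g hg => ?_⟩
  rw [kernel_def, borelSum_def]
  have hs : Function.support (fun γ : (quasiSplit F E c 2).arithmeticSubgroup => f (g⁻¹ * (γ : (quasiSplit F E c 2).Adelic) * g)) ⊆
      (arithmeticBorel F E c 2 : Set (quasiSplit F E c 2).arithmeticSubgroup) := by
    intro γ hγ
    by_contra hγB
    exact hγ (hc₀ g hg γ hγB)
  exact (tsum_subtype_eq_of_support_subset hs).symm

end UnitaryGroup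

end Literature.NumberTheory.Automorphic
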